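import Summits.BirchSwinnertonDyer.BirchSwinnertonDyer.Theorems.ResidualThetaTransportAtTwoThetaLayerLambdaCongruenceAtTwoStarAssembly
import Literature.NumberTheory.EllipticCurves.PeriodLatticeRationalityUnconditionalProofs
import Literature.NumberTheory.EllipticCurves.ModularParametrizationDegreeHoldsProofs
import Literature.NumberTheory.EllipticCurves.AnalyticIsogenyDescentProofs
import Literature.NumberTheory.EllipticCurves.IsogenyDualInseparableProofs
import Literature.NumberTheory.EllipticCurves.RationalIsogenyDegrees
import Literature.NumberTheory.EllipticCurves.ModularCurveRealPeriodProofs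
import HarnessLib

/-!
# Route `ResidualThetaTransportAtTwo`, crux Kμ⁺ `SignedMuVanishingAtTwoPlus` (stmt-BirchSwinnertonDyer-20689), line
# `birth`, stub `stub_flatMuZeroAtTwo`: the (MO⁺) DICTIONARY, part 5 — hypothesis (II) «`Ω⁺_f/2 ∉ Λ_f`» (the period lattice
# of the habitat newform is RHOMBIC) from `Δ_W < 0`, good supersingular reduction at `2`, and the Mazur–Kenku fact

Cell `bsd-wall`, width seat `bsd-wall-rtt-p4-w2` (g4). THEOREMS ONLY (no `def`, no `sorry`); helper `--supports` the crux; closes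
nothing. BSD is not proved by this. ONE named fact enters as a hypothesis: `mazurKenku_exists_cyclic_isogeny` (a CYCLIC
`ℚ`-isogeny between isogenous curves). Everything else is a theorem of the tree: `E_f = ℂ/Λ_f` is an elliptic curve over `ℚ`
with Néron lattice `Λ_f` (`IsNewform0.exists_shortModel_periodLattice`), `c·Λ_f ⊆ Λ_W`
(`IsNewformOf.exists_maninConstant_ne_zero_holds`, Shimura + Faltings, both discharged in the tree), analytic isogenies descend
(`isIsogenous_of_forall_mul_mem_lattice`), dual isogenies (`IsIsogenous.symm_of_isElliptic`), and the sibling Kan⁺ lineage's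
rhombic-lattice kit (`neronLattice_rhombic_of_Δ_neg`, `exists_real_oddIndex_latticeBridge_of_goodSS_two`,
`periodLattice_rhombic_of_latticeBridge`).

## What is proved
* `periodLattice_rhombic_of_goodSS_of_Δ_neg` — for `W/ℚ` globally minimal, good supersingular at `2`, `Δ_W < 0`, with newform
  `f`: some `z ∈ Λ_f` has `z + z̄ ∉ 2Λ_f` (complex conjugation is not the identity on `Λ_f/2Λ_f`). Chain: `Λ_W` is rhombic
  (`Δ_W < 0`); a cyclic isogeny `W → E_f` (Mazur–Kenku) has ODD degree (no rational `2`-torsion at a good supersingular `2`) and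
  a real multiplier, giving an odd-index real bridge `Λ_W ⇝ Λ_{E_f} = Λ_f`; rhombicity passes along it.
* `half_plusPeriod_not_mem_of_goodSS_of_Δ_neg` — hence `Ω⁺_f/2 ∉ Λ_f` (as `re Λ_f = ℤ·Ω⁺_f/2`, `Ω⁺_f/2 ∈ Λ_f` would make
  every `z + z̄ = 2 re z` a double in `Λ_f`): hypothesis (II) `hrh` of `…MultOneFlat.multOnePlus_of_card_le_four` /
  `flatAtTwo_of_card_le_four`, for the habitat⁺.

References: B. Mazur, Invent. Math. 44 (1978) Thm. 1 [Mazur1978]; M. A. Kenku, J. LMS 23 (1981) [Kenku1982]; J. E. Cremona,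
*Algorithms for modular elliptic curves* (1997) §2.8, §2.10, §2.14 [CremonaAlgorithms1997]; A. W. Knapp, *Elliptic Curves* (1993)
Thm. 11.74 [Knapp1993]; J. H. Silverman, AEC Thm. VI.4.1, VI.5.3, III.6.1 [SilvermanAEC2009].
-/

set_option autoImplicit false
set_option linter.dupNamespace false

noncomputable section

open scoped Classical MatrixGroups ModularForm ComplexConjugate

open CongruenceSubgroup Complex WeierstrassCurve Literature.NumberTheory.EllipticCurves
  Literature.NumberTheory.EllipticCurves.ModularForms Literature.NumberTheory.EllipticCurves.Rank1Residual
  Summit.BirchSwinnertonDyer.BirchSwinnertonDyer.Theorems.ThetaLayerLambdaCongruenceAtTwo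

namespace Summit.BirchSwinnertonDyer.BirchSwinnertonDyer.Theorems.SignedMuAtTwo

namespace MultOneDictionary

variable {W : WeierstrassCurve ℚ} [W.IsElliptic] [W.IsGloballyMinimal]

/-- **The period lattice of the newform of a good-supersingular-at-`2` curve with `Δ < 0` is rhombic.** `W/ℚ` globally minimal,
`GoodSS W 2`, `Δ_W < 0`, newform `f` (`IsNewformOf W f`); granted `mazurKenku_exists_cyclic_isogeny`: some `z ∈ Λ_f` has
`z + z̄ ≠ 2w` for all `w ∈ Λ_f`. Proof: `E_f = ℂ/Λ_f` is an elliptic curve over `ℚ` with Néron lattice `Λ_f`, `ℚ`-isogenous to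
`W` (`c Λ_f ⊆ Λ_W`, analytic isogenies descend); a cyclic isogeny `ψ : W → E_f` has odd degree (a good supersingular `2` leaves
no rational `2`-torsion) and a real multiplier `α` (`αΛ_W ⊆ Λ_f`, `deg ψ · Λ_f ⊆ αΛ_W`); `Λ_W` is rhombic since `Δ_W < 0`,
and rhombicity is invariant under real scaling and odd-index passage. [cite: CremonaAlgorithms1997, §2.10 (pp. 29–30) and §2.14]
[cite: Knapp1993, Thm. 11.74 (d)] [cite: Mazur1978, Thm. 1] [cite: SilvermanAEC2009, Thm. VI.4.1 and Thm. III.6.1] -/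
theorem periodLattice_rhombic_of_goodSS_of_Δ_neg (hMK : mazurKenku_exists_cyclic_isogeny)
    (hss : GoodSS W 2) (hΔ : W.Δ < 0) {N : ℕ} [NeZero N] {f : CuspForm (Gamma0 N) 2} (hf : IsNewformOf W f) :
    ∃ z ∈ periodLattice f, ∀ w ∈ periodLattice f, z + conj z ≠ 2 * w := by
  have hQ : coeffField f = ⊥ := hf.coeffField_eq_bot
  -- `E_f = ℂ/Λ_f`, an elliptic curve over `ℚ` with Néron lattice `Λ_f`
  obtain ⟨Lf, a₄, a₆, hLf, hE, hNer⟩ := hf.1.exists_shortModel_periodLattice hQ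
  haveI := hE
  have hmemLf : ∀ z : ℂ, z ∈ Lf.lattice ↔ z ∈ periodLattice f := fun z ↦ by
    rw [← Submodule.mem_toAddSubgroup, hLf]
  -- a Néron period pair of `W`, and `c Λ_f ⊆ Λ_W`
  obtain ⟨LW, hLW⟩ := exists_isNeronLatticeOf W
  obtain ⟨c, hc0, hcle⟩ := IsNewformOf.exists_maninConstant_ne_zero_holds hf hLW
  -- `E_f ~ W` (the analytic isogeny `z ↦ cz` descends), hence `W ~ E_f`
  have hisoEW : IsIsogenous ({ a₁ := 0, a₂ := 0, a₃ := 0, a₄ := a₄, a₆ := a₆ } : WeierstrassCurve ℚ) W :=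
    isIsogenous_of_forall_mul_mem_lattice hNer.1 hNer.2 hLW.1 hLW.2 (c := (c : ℚ)) (by exact_mod_cast hc0)
      (fun z hz ↦ by rw [Rat.cast_intCast]; exact hcle z ((hmemLf z).mp hz))
  have hisoWE : IsIsogenous W ({ a₁ := 0, a₂ := 0, a₃ := 0, a₄ := a₄, a₆ := a₆ } : WeierstrassCurve ℚ) :=
    hisoEW.symm_of_isElliptic
  -- a cyclic isogeny `W → E_f` (Mazur–Kenku) gives a real odd-index bridge `Λ_W ⇝ Λ_f`
  obtain ⟨ψ, hcyc, -⟩ := hMK W _ hisoWE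
  obtain ⟨α, m, hα, hm, hWB, hBW⟩ := exists_real_oddIndex_latticeBridge_of_goodSS_two W _ hss ψ hcyc hLW hNer
  -- rhombicity: `Λ_W` (from `Δ_W < 0`) ⇒ `Λ_f`
  refine periodLattice_rhombic_of_latticeBridge f (WeierstrassCurve.isReal_of_g₂_g₃_eq (K := ℚ) hLW.1 hLW.2)
    (W.neronLattice_rhombic_of_Δ_neg hΔ hLW) Lf.lattice.toAddSubgroup (c := (1 : ℝ)) one_ne_zero (fun z ↦ ?_) hα hm
    (fun z hz ↦ hWB z hz) (fun b hb ↦ hBW b hb)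
  rw [Submodule.mem_toAddSubgroup, hmemLf]
  constructor
  · intro hz
    exact ⟨z, hz, by simp⟩
  · rintro ⟨w, hw, rfl⟩
    simpa using hw

/-- **(II) for the habitat⁺: `Ω⁺_f/2` is not a period of the newform.** `W/ℚ` globally minimal, good supersingular at `2`,
`Δ_W < 0`, newform `f`; granted `mazurKenku_exists_cyclic_isogeny`: `Ω⁺_f/2 ∉ Λ_f` — the hypothesis `hrh` of
`…MultOneFlat.multOnePlus_of_card_le_four` / `flatAtTwo_of_card_le_four`. (If `Ω⁺_f/2 ∈ Λ_f` then, as `re Λ_f = ℤ·Ω⁺_f/2`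
(`realPeriods_eq_zmultiples_of_plusPeriod_pos`), every `z + z̄ = 2 re z`, `z ∈ Λ_f`, is a double in `Λ_f`, contradicting
`periodLattice_rhombic_of_goodSS_of_Δ_neg`.) [cite: CremonaAlgorithms1997, §2.8 and §2.10 (pp. 29–30)] [cite: Mazur1978, Thm. 1] -/
theorem half_plusPeriod_not_mem_of_goodSS_of_Δ_neg (hMK : mazurKenku_exists_cyclic_isogeny)
    (hss : GoodSS W 2) (hΔ : W.Δ < 0) {N : ℕ} [NeZero N] {f : CuspForm (Gamma0 N) 2} (hf : IsNewformOf W f) :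
    ((plusPeriod f / 2 : ℝ) : ℂ) ∉ periodLattice f := by
  intro hhalf
  have hQ : coeffField f = ⊥ := hf.coeffField_eq_bot
  have hΩ : 0 < plusPeriod f := IsNewform0.plusPeriod_pos_holds hf.1 hQ
  obtain ⟨z, hz, hzw⟩ := periodLattice_rhombic_of_goodSS_of_Δ_neg hMK hss hΔ hf
  have hre : realPeriods f = AddSubgroup.zmultiples (plusPeriod f / 2) := realPeriods_eq_zmultiples_of_plusPeriod_pos f hΩ
  have hzre : z.re ∈ realPeriods f := AddSubgroup.mem_map.mpr ⟨z, hz, rfl⟩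
  rw [hre, AddSubgroup.mem_zmultiples_iff] at hzre
  obtain ⟨k, hk⟩ := hzre
  refine hzw (k • ((plusPeriod f / 2 : ℝ) : ℂ)) (AddSubgroup.zsmul_mem _ hhalf k) ?_
  have h1 : (z.re : ℂ) = (k : ℂ) * ((plusPeriod f / 2 : ℝ) : ℂ) := by
    rw [← hk, zsmul_eq_mul]; push_cast; ring
  rw [Complex.add_conj, zsmul_eq_mul]
  push_cast
  rw [show ((z.re : ℝ) : ℂ) = (k : ℂ) * ((plusPeriod f / 2 : ℝ) : ℂ) from h1]
  push_cast
  ring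

end MultOneDictionary

end Summit.BirchSwinnertonDyer.BirchSwinnertonDyer.Theorems.SignedMuAtTwo

end
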